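import Summits.QuantumFields.BalabanUV.Beta.FP.LevelZeroDoorSocket
import Summits.QuantumFields.BalabanUV.Beta.FP.NestedStepLawTorusLevelZeroDoorCompanion

/-!
# `BalabanUV.Beta.FP.LevelZeroDoorSocketCompanion` — road «FP» for binder row D1, ROUTE T, memo `N2B-DESIGN.md` (31d)∕(32e)∕(33e)∕§34: **STEPS 1+2 OF THE
# LEVEL-0 ASSEMBLY AGAINST THE DOOR WITH ITS COMPANION PAIR** — leaf-02's level-0 door I-7 `…FP.NestedStepLawTorusLevelZeroDoorCompanion` (p355451 ✓; the
# R-FP-59 U-file shape: the (Δ1)∕(Δ2) companions `Λ₁ Λ₂` DISPLAYED with graded parities, rows `hdead a1 a2` for the TOTAL jets, `c2 t2 d2 q2 k1 k2 a0 hH₂t`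
# INSIDE) FEEDS THE SOCKET #36b `LevelZeroDoorSocket` BY ONE TERM; the three `hessT` torus kernels on every top-bond direction family

WHY.  #36b `mixedVar_kernel_law_of_levelZero_door` is STEP 1 with the door as ONE hypothesis `hdoor` in the U-file's conclusion SHAPE, its companion slots
`ΛN ΛG N₂c G₂c ΦN ΦF ΨG P` abstract; #37 `LevelZeroDoorSocketU23Pure` filled them EMPTY for the pure door U23♭.  THIS FILE is the ADAPTER for the door WITH
COMPANIONS, I-7: its direction-free binders VERBATIM; its direction-dependent jets as FUNCTIONS of the direction `v` of an ABSTRACT module `V` read through two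
displayed linear read-outs `h = hv v`, `λ = lv v` (leaf-06 g26 W-3) by I-7's own defining right-hand sides (`hW₁f hDb₁f hW₂f hH₁f hH′₁f hH₂f hH′₂f h𝔔′₁f` —
`hH₂ hH′₂` without the free `G`, POLARISED); THE COMPANION SLOTS FILLED BY I-7's LETTERS: `ΛN v := Q₁₀ᵀ Λ₁(v) Q₁₀` and `ΛG v := Λ₁(v)` with `Λ₁f` LINEAR in
the direction and ANTISYMMETRIC along every direction (I-7's `hΛ₁t`); `N₂c := N₂cf` DISPLAYED as a bilinear map whose DIAGONAL is I-7's (Δ2) letter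
`−(Q₁₁h)ᵀΛ₁Q₁₀ − (Q₁₁h)ᵀΛ₁Q₁₀ + Q₁₀ᵀΛ₁Q₁₁h + Q₁₀ᵀΛ₁Q₁₁h` plus I-7's two graded commutators `(Q₁₀ᵀΛ₁Q₁₀)X − Xᵀ(Q₁₀ᵀΛ₁Q₁₀)` (`X = −c•diag(λ∘pr)` the pinned
generator); `G₂c := 0`; the FREE element is the PAIR `e = (G, Λ₂)` of a symmetric fine and a symmetric coarse matrix (`P e := Gᵀ = G ∧ Λ₂ᵀ = Λ₂`), entering
through `ΦN e := G + Q₁₀ᵀ Λ₂ Q₁₀`, `ΦF e := G`, `ΨG e := Λ₂`; I-7's displayed ROWS `hdead a1 a2` as hypotheses FOR EVERY direction (the witnesses `Y₁ Y₂` as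
functions of the direction and of the free pair); the order-2 AVERAGING bindings DISPLAYED as bilinear maps (R-FP-63 (iv) ∕ an2 R-D1-g44-3: `NY₂f` with its
diagonal = the U-file's `h𝔔′₂` left side, and the bilinearity of `Q₂₂`); RIGHT INVERSES `XN XF XG` of the three base systems displayed (leaf-05's
`RelInvPeriodised*` at the record).  CONCLUSION: #24's `hessT` identity of the packed legs against the packed graded vertices for the systems `kkt H₀ [𝔔₀;P]`,
`kkt H₀ [Q₁₀;τ₁]`, `kkt S₁₁ [Q₂₀;τ₂]` on every top-bond family `d` with every pair of symmetric free families `EF` (fine: the `G`'s) and `EC` (coarse: the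
`Λ₂`'s) — the one-shot second slot reads `½(H′₂ᵏˡ + N₂cᵏˡ + H′₂ˡᵏ + N₂cˡᵏ) + (EFᵏˡ + Q₁₀ᵀ ECᵏˡ Q₁₀)`, the coarse one `… + ((L EFᵏˡ I)₁₁ + ECᵏˡ)`.  PROOF: #36a
`hessT_law_of_mixedVar_law` ∘ ONE `mixedVar_kernel_law_of_levelZero_door …` whose `hdoor` is I-7 BY TERM followed by ONE regrouping of the one-shot second
slot (`(H′₂ + G) + (C + [P,X] + [P,X]) = H′₂ + N₂c v v + (G + Q₁₀ᵀΛ₂Q₁₀)`, `abel` after `hN₂cd`) and `simpa only [add_zero]` (the empty `G₂c`).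
[folklore]; no `def`, no `def … : Prop`, nothing cited, 0 sorry.

HONEST DEPENDENCY (page 1, mandatory): continuum YM on T⁴ ⇐ BetaPertH ∧ nine spine estimates (0/9 proved); BetaPertH ⇐ (D1) ∧ (D4) ∧ CAP+tail;
G-an2-4 gates asym, D1 and NE2/3/4.  HONEST FRAMING (cell contract, verbatim): «discharging `BetaPertH` makes Bałaban's UV stability UNCONDITIONAL —
a real constructive-QFT result; it is NOT the continuum limit and NOT the Clay problem.»  ABSOLUTE RULE (cell charter, verbatim): «No internally-minted
statement may enter as a cited fact. Every hypothesis is either kernel-proved in this package or a verbatim quotation of a PUBLISHED theorem with page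
reference. The manuscript(s) under audit are NOT citable for their own disputed steps — they are the thing under adjudication; programme-internal
(2001/route/tribunal) claims are never citable.»  I-7's rows are HYPOTHESES here, per direction; the companion's bilinearity and the averaging bindings are
DISPLAYED, not derived (nothing of the dictionary ∕ Bałaban's asserted); 0 estimates; 0∕4 row-D1 binders (hW, hR, D1Tel, D1Rep); NOT (T-ID), NOT SDF,
NOT D1, NOT BetaPertH, NOT continuum, NOT Clay.  Road «FP» OWNER, b2b-balaban-beta-d1-p3 gen 25, 2026-08-23.  No existing file touched.
-/

noncomputable section

open scoped BigOperators Matrix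


namespace Summit.QuantumFields.BalabanUV.Beta.FP.LevelZeroDoorSocketCompanion

open Matrix Finset
open Literature.Probability.LatticeModels (Torus.proj)
open Literature.MathematicalPhysics.QuantumFieldTheory.Balaban1983to89
open Literature.MathematicalPhysics.QuantumFieldTheory.Balaban1983to89.Beta
open Literature.MathematicalPhysics.QuantumFieldTheory.Balaban1983to89.Beta.Composition (kkt)
open Literature.MathematicalPhysics.QuantumFieldTheory.Balaban1983to89.Beta.CompositionSingular (effForm flucCov minOp minOpL)
open Literature.MathematicalPhysics.QuantumFieldTheory.LatticeForm (quo)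
open B5Prop11Plancherel (fine)
open B6Lemma24Torus (pbox mem_pbox)
open AffineAveraging (Site box toSite unitVec)
open AveragingContoursRooted (ctr ctrOff ctrOff_mem_box)
open SymAveragingHessianCounts (symVhSAt)
open OneStepResolventKernel (Fib KInv)
open InterLevelTransport (SLam)
open BalabanStepJets (lamCoeffOf)
open Summit.QuantumFields.BalabanUV.Beta.SymAveragingHessianCounts (symHessFFAt)
open Summit.QuantumFields.BalabanUV.Beta.BorderedHessian (bhKStepAt stepScale)
open Summit.QuantumFields.BalabanUV.Beta.DshAn1 (Dsh)
open Summit.QuantumFields.BalabanUV.Beta.SymShiftedSpread (bhKStepSh)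
open Summit.QuantumFields.BalabanUV.Beta.D1BFx.LogDetSecondVariation (secondVar)
open Summit.QuantumFields.BalabanUV.Beta.FP.SecondVarPolarisation (mixedVar)
open Summit.QuantumFields.BalabanUV.Beta.D1BFx.MixedVarPackedHess (hessT)
open Summit.QuantumFields.BalabanUV.Beta.FP.KernelPeriodisationFib (Idx perF)
open Summit.QuantumFields.BalabanUV.Beta.FP.KernelPeriodisationFibLoc (dper)
open Summit.QuantumFields.BalabanUV.Beta.FP.TorusGaugeCovariance (tdelta tgrad)
open Summit.QuantumFields.BalabanUV.Beta.FP.TorusGaugeCovarianceCoarse (coarsePt tgradBlock)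
open Summit.QuantumFields.BalabanUV.Beta.FP.TorusCombRows (Res combRowsT combBondT)
open Summit.QuantumFields.BalabanUV.Beta.FP.TorusCombNestedBasis (resBigEquiv)
open Summit.QuantumFields.BalabanUV.Beta.GAN24.FineReadoutCauchyFrame (toSite_mem_range)
open StepJetData (wilsonA)
open Summit.QuantumFields.BalabanUV.Beta.FP.NestedStepLawTorusLevelZeroDoorCompanion (secondVar_oneShot_nestedStepLaw_torus_levelZero_door_companion)
open Summit.QuantumFields.BalabanUV.Beta.SymSecondOrderTablesAn1 (symVh₂SAn1)
open ExpKernelCalculus (MKer)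
open B4TorusKernel.MultiPeriod (translate)
open WilsonBiStencil (wilsonW₂)
open WilsonVertex2Sym (wsym22)
open Summit.QuantumFields.BalabanUV.Beta.FP.DirectionalDoorKernelLaw (lin_sum_smul bilin_sum_sum_smul_left bilin_sum_sum_smul_right)
open Summit.QuantumFields.BalabanUV.Beta.FP.LevelZeroDoorShapes (shift_apply_lin)
open Summit.QuantumFields.BalabanUV.Beta.FP.LevelZeroDoorSocket (mixedVar_kernel_law_of_levelZero_door)

variable (M' : Fin (3 + 1) → ℕ) [∀ μ, NeZero (M' μ)] {Lc : ℕ} [NeZero Lc]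

set_option synthInstance.maxSize 1024 in
set_option maxHeartbeats 1600000 in
/-- [folklore] **STEPS 1+2 OF THE LEVEL-0 ASSEMBLY AGAINST THE DOOR WITH ITS COMPANION PAIR (I-7)**: I-7's binders VERBATIM (direction-free) ∕ as
FUNCTIONS of the direction (direction-dependent, I-7's own right-hand sides), the order-1 coarse companion `Λ₁f` linear and antisymmetric along every
direction, the order-2 direction companion `N₂cf` displayed with its diagonal = I-7's (Δ2) letter + graded commutators, I-7's rows `hdead a1 a2` per
direction, the order-2 averaging bindings displayed as bilinear maps, right inverses `XN XF XG` of the three base systems; then the `hessT` kernels of the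
one-shot ∕ fine ∕ coarse systems on the packed legs satisfy #24's identity on every top-bond family `d` with every pair of symmetric free families `EF`
(fine) and `EC` (coarse) — STEP 2 (#36a `hessT_law_of_mixedVar_law`) ∘ STEP 1 (#36b `mixedVar_kernel_law_of_levelZero_door`, its `hdoor` = I-7 by term +
one `abel` regrouping of the one-shot second slot + `simpa only [add_zero]`). -/
theorem hessT_kernel_law_levelZero_companion
    {κ : Type*} [Fintype κ] [DecidableEq κ]
    -- the direction module and its two DISPLAYED linear read-outs (fine direction `h = hv v`, gauge parameter `λ = lv v`); at the nested layer
    -- `V := σ → ℝ` (top-bond weights) with `hv r := Σ_k r k • col k`, or the comb-dead submodule — leaf-06 g26 W-3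
    {V : Type*} [AddCommGroup V] [Module ℝ V]
    (hv : V → (↥(pbox (fine Lc M')) × Fin (3 + 1) → ℝ)) (lv : V → (↥(pbox (fine Lc M')) → ℝ))
    (hhv : ∀ (c : ℝ) (x y : V), hv (c • x + y) = c • hv x + hv y) (hlv : ∀ (c : ℝ) (x y : V), lv (c • x + y) = c • lv x + lv y)
    (hM' : ∀ i, Lc ∣ M' i)
    (pμ' : κ → ↥(pbox M'))
    (mμ' : κ → Fin (3 + 1))
    (hfμ' : Function.Injective (fun a : κ => ((pμ' a, Sum.inr (mμ' a)) : Idx M' (Fib 3))))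
    (hcoarse' : ∀ (s : ↥(pbox M')) (m : Fin (3 + 1)),
      ((s, Sum.inr m) : Idx M' (Fib 3)) ∈ Set.range (fun a : κ => ((pμ' a, Sum.inr (mμ' a)) : Idx M' (Fib 3))) ↔ Torus.proj Lc (s : Site (3 + 1)) = 0)
    {H₀ : Matrix (↥(pbox (fine Lc M')) × Fin (3 + 1)) (↥(pbox (fine Lc M')) × Fin (3 + 1)) ℝ}
    {Q₁₀ : Matrix (↥(pbox M') × Fin (3 + 1)) (↥(pbox (fine Lc M')) × Fin (3 + 1)) ℝ}
    {τ₁ : Matrix (Res (ctr (3 + 1) Lc) Lc (fine Lc M')) (↥(pbox (fine Lc M')) × Fin (3 + 1)) ℝ}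
    {τ₂ : Matrix (Res (ctr (3 + 1) Lc) Lc M') (↥(pbox M') × Fin (3 + 1)) ℝ}
    {D₁ : Matrix (↥(pbox (fine Lc M')) × Fin (3 + 1)) (Res (ctr (3 + 1) Lc) Lc (fine Lc M')) ℝ}
    {D₂ : Matrix (↥(pbox (fine Lc M')) × Fin (3 + 1)) (Res (ctr (3 + 1) Lc) Lc M') ℝ}
    {Dbar : Matrix (↥(pbox M') × Fin (3 + 1)) (Res (ctr (3 + 1) Lc) Lc M') ℝ}
    {P : Matrix (Res (ctr (3 + 1) Lc) Lc M' ⊕ Res (ctr (3 + 1) Lc) Lc (fine Lc M')) (↥(pbox (fine Lc M')) × Fin (3 + 1)) ℝ}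
    (hH₀ : H₀ = (perF (fine Lc M') (bhKStepSh 3 Lc (Dsh Lc) 0)).submatrix
        (fun b : ↥(pbox (fine Lc M')) × Fin (3 + 1) => ((b.1, Sum.inl b.2) : Idx (fine Lc M') (Fib 3)))
        (fun b : ↥(pbox (fine Lc M')) × Fin (3 + 1) => ((b.1, Sum.inl b.2) : Idx (fine Lc M') (Fib 3))))
    (hQ₁₀ : Q₁₀ = (perF (fine Lc M') (bhKStepSh 3 Lc (Dsh Lc) 0)).submatrix
        (fun a : ↥(pbox M') × Fin (3 + 1) => ((coarsePt M' Lc a.1, Sum.inr a.2) : Idx (fine Lc M') (Fib 3)))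
        (fun b : ↥(pbox (fine Lc M')) × Fin (3 + 1) => ((b.1, Sum.inl b.2) : Idx (fine Lc M') (Fib 3))))
    (hτ₁ : τ₁ = (combRowsT (ctr (3 + 1) Lc) Lc (fine Lc M')).submatrix id
        (fun b : ↥(pbox (fine Lc M')) × Fin (3 + 1) => ((b.1, Sum.inl b.2) : Idx (fine Lc M') (Fib 3))))
    (hτ₂ : τ₂ = (combRowsT (ctr (3 + 1) Lc) Lc M').submatrix id (fun b : ↥(pbox M') × Fin (3 + 1) => ((b.1, Sum.inl b.2) : Idx M' (Fib 3))))
    (hD₁ : D₁ = (tgrad (fine Lc M')).submatrix (fun b : ↥(pbox (fine Lc M')) × Fin (3 + 1) => ((b.1, Sum.inl b.2) : Idx (fine Lc M') (Fib 3)))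
        (Subtype.val : Res (ctr (3 + 1) Lc) Lc (fine Lc M') → ↥(pbox (fine Lc M'))))
    (hD₂ : D₂ = (tgradBlock M' Lc).submatrix (fun b : ↥(pbox (fine Lc M')) × Fin (3 + 1) => ((b.1, Sum.inl b.2) : Idx (fine Lc M') (Fib 3)))
        (Subtype.val : Res (ctr (3 + 1) Lc) Lc M' → ↥(pbox M')))
    (hDbar : Dbar = Matrix.of fun (a : ↥(pbox M') × Fin (3 + 1)) (t : Res (ctr (3 + 1) Lc) Lc M') =>
        stepScale 3 Lc 0 * (((box (3 + 1) Lc).card : ℝ) * tgrad M' (a.1, Sum.inl a.2) t.1))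
    (hP : P = (combRowsT ((Lc : ℤ) • ctr (3 + 1) Lc + ctr (3 + 1) Lc) (Lc * Lc) (fine Lc M')).submatrix
        (resBigEquiv Lc Lc (ctr (3 + 1) Lc) (ctr (3 + 1) Lc) M' (Nat.pos_of_ne_zero (NeZero.ne Lc)) (toSite_mem_range (ctrOff_mem_box (Nat.one_le_iff_ne_zero.mpr (NeZero.ne Lc))))
          (Nat.pos_of_ne_zero (NeZero.ne Lc)) (toSite_mem_range (ctrOff_mem_box (Nat.one_le_iff_ne_zero.mpr (NeZero.ne Lc))))).symm
        (fun b : ↥(pbox (fine Lc M')) × Fin (3 + 1) => ((b.1, Sum.inl b.2) : Idx (fine Lc M') (Fib 3))))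
    {Q₂₀ : Matrix κ (↥(pbox M') × Fin (3 + 1)) ℝ}
    (hQ₂₀ : Q₂₀ = (perF M' (bhKStepSh 3 Lc (Dsh Lc) 1)).submatrix (fun a : κ => ((pμ' a, Sum.inr (mμ' a)) : Idx M' (Fib 3)))
        (fun b : ↥(pbox M') × Fin (3 + 1) => ((b.1, Sum.inl b.2) : Idx M' (Fib 3))))
    (Q₁₁ : (↥(pbox (fine Lc M')) × Fin (3 + 1) → ℝ) → Matrix (↥(pbox M') × Fin (3 + 1)) (↥(pbox (fine Lc M')) × Fin (3 + 1)) ℝ)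
    (hQ₁₁ : ∀ w, Q₁₁ w = ∑ b : ↥(pbox (fine Lc M')) × Fin (3 + 1), w b •
        (perF (fine Lc M') (dper (fine Lc M') (symVhSAt (ctr (3 + 1) Lc) 3 Lc rfl b.2 (b.1 : Site (3 + 1))))).submatrix
          (fun a : ↥(pbox M') × Fin (3 + 1) => ((coarsePt M' Lc a.1, Sum.inr a.2) : Idx (fine Lc M') (Fib 3)))
          (fun b : ↥(pbox (fine Lc M')) × Fin (3 + 1) => ((b.1, Sum.inl b.2) : Idx (fine Lc M') (Fib 3))))
    (Q₂₁ : (↥(pbox (fine Lc M')) × Fin (3 + 1) → ℝ) → Matrix κ (↥(pbox M') × Fin (3 + 1)) ℝ)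
    (hQ₂₁ : ∀ w, Q₂₁ w = ∑ b : ↥(pbox (fine Lc M')) × Fin (3 + 1), w b •
        ∑ a' : ↥(pbox M') × Fin (3 + 1), (stepScale 3 Lc 1 / (stepScale 3 Lc 0 ^ 2 * ((box (3 + 1) Lc).card : ℝ)) * Q₁₀ a' b) •
          (perF M' (dper M' (symVhSAt (ctr (3 + 1) Lc) 3 Lc rfl a'.2 (a'.1 : Site (3 + 1))))).submatrix (fun a : κ => ((pμ' a, Sum.inr (mμ' a)) : Idx M' (Fib 3)))
            (fun b : ↥(pbox M') × Fin (3 + 1) => ((b.1, Sum.inl b.2) : Idx M' (Fib 3))))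
    (w : ℝ)
    (N := Lc)
    (hN : 2 ≤ N)
    {W : Fin (3 + 1) → Site (3 + 1) → Fin (3 + 1) → Site (3 + 1) → MKer (3 + 1) (Fib 3)}
    (hW : W = fun κ' u' κ u x z a c =>
      ∑' n : Site (3 + 1), wilsonW₂ 3 ((8 * (N : ℝ) ^ 2)⁻¹ • wsym22 N) κ u κ' (translate (fine Lc M') u' n) x z a c)
    {W₁₂ : Fin (3 + 1) → Site (3 + 1) → Fin (3 + 1) → Site (3 + 1) → MKer (3 + 1) (Fib 3)}
    (hW₁₂ : W₁₂ = fun κ' u' κ u x z a c => ∑' n : Site (3 + 1), symVh₂SAn1 3 Lc κ u κ' (translate (fine Lc M') u' n) x z a c)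
    (Q₁₂ : (↥(pbox (fine Lc M')) × Fin (3 + 1) → ℝ) → (↥(pbox (fine Lc M')) × Fin (3 + 1) → ℝ) → Matrix (↥(pbox M') × Fin (3 + 1)) (↥(pbox (fine Lc M')) × Fin (3 + 1)) ℝ)
    (hQ₁₂ : ∀ w w', Q₁₂ w w' = -(((Lc : ℝ) ^ (3 + 1) * stepScale 3 Lc 0)⁻¹) • ∑ b : ↥(pbox (fine Lc M')) × Fin (3 + 1), ∑ b' : ↥(pbox (fine Lc M')) × Fin (3 + 1), (w b * w' b') •
        (perF (fine Lc M') (dper (fine Lc M') (W₁₂ b'.2 (b'.1 : Site (3 + 1)) b.2 (b.1 : Site (3 + 1))))).submatrix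
          (fun a : ↥(pbox M') × Fin (3 + 1) => ((coarsePt M' Lc a.1, Sum.inr a.2) : Idx (fine Lc M') (Fib 3)))
          (fun c : ↥(pbox (fine Lc M')) × Fin (3 + 1) => ((c.1, Sum.inl c.2) : Idx (fine Lc M') (Fib 3))))
    {W₂₂ : Fin (3 + 1) → Site (3 + 1) → Fin (3 + 1) → Site (3 + 1) → MKer (3 + 1) (Fib 3)}
    (hW₂₂ : W₂₂ = fun κ' u' κ u x z a c => ∑' n : Site (3 + 1), symVh₂SAn1 3 Lc κ u κ' (translate M' u' n) x z a c)
    (Q₂₂ : (↥(pbox (fine Lc M')) × Fin (3 + 1) → ℝ) → (↥(pbox (fine Lc M')) × Fin (3 + 1) → ℝ) → Matrix κ (↥(pbox M') × Fin (3 + 1)) ℝ)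
    (hQ₂₂ : ∀ w w', Q₂₂ w w' = -(((Lc : ℝ) ^ (3 + 1) * stepScale 3 Lc 1)⁻¹) • (∑ a' : ↥(pbox M') × Fin (3 + 1), ∑ a'' : ↥(pbox M') × Fin (3 + 1),
          (((stepScale 3 Lc 1 / (stepScale 3 Lc 0 ^ 2 * ((box (3 + 1) Lc).card : ℝ))) * ∑ b : ↥(pbox (fine Lc M')) × Fin (3 + 1), Q₁₀ a' b * w b) * ((stepScale 3 Lc 1 / (stepScale 3 Lc 0 ^ 2 * ((box (3 + 1) Lc).card : ℝ))) * ∑ b : ↥(pbox (fine Lc M')) × Fin (3 + 1), Q₁₀ a'' b * w' b)) •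
            (perF M' (dper M' (W₂₂ a''.2 (a''.1 : Site (3 + 1)) a'.2 (a'.1 : Site (3 + 1))))).submatrix (fun a : κ => ((pμ' a, Sum.inr (mμ' a)) : Idx M' (Fib 3)))
            (fun b : ↥(pbox M') × Fin (3 + 1) => ((b.1, Sum.inl b.2) : Idx M' (Fib 3)))))
    {Γ : Matrix (↥(pbox (fine Lc M')) × Fin (3 + 1)) (↥(pbox (fine Lc M')) × Fin (3 + 1)) ℝ}
    {I : Matrix (↥(pbox (fine Lc M')) × Fin (3 + 1)) ((↥(pbox M') × Fin (3 + 1)) ⊕ Res (ctr (3 + 1) Lc) Lc (fine Lc M')) ℝ}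
    {L : Matrix ((↥(pbox M') × Fin (3 + 1)) ⊕ Res (ctr (3 + 1) Lc) Lc (fine Lc M')) (↥(pbox (fine Lc M')) × Fin (3 + 1)) ℝ}
    {S : Matrix ((↥(pbox M') × Fin (3 + 1)) ⊕ Res (ctr (3 + 1) Lc) Lc (fine Lc M')) ((↥(pbox M') × Fin (3 + 1)) ⊕ Res (ctr (3 + 1) Lc) Lc (fine Lc M')) ℝ}
    (hΓ : flucCov H₀ (fromRows Q₁₀ τ₁) = Γ)
    (hI : minOp H₀ (fromRows Q₁₀ τ₁) = I)
    (hL : minOpL H₀ (fromRows Q₁₀ τ₁) = L)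
    (hS : effForm H₀ (fromRows Q₁₀ τ₁) = S)

    {𝔔₀ : Matrix κ (↥(pbox (fine Lc M')) × Fin (3 + 1)) ℝ} (h𝔔₀ : Q₂₀ * Q₁₀ = 𝔔₀)
    -- I-7's direction-dependent generator jets as FUNCTIONS of the direction `v` (I-7's `hW₁ hDb₁ hW₂ hH₁ hH₂ hH'₁ hH'₂` right-hand sides VERBATIM, `G` taken out)
    (W₁f : V → Matrix (↥(pbox (fine Lc M')) × Fin (3 + 1)) (Res (ctr (3 + 1) Lc) Lc M' ⊕ Res (ctr (3 + 1) Lc) Lc (fine Lc M')) ℝ)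
    (hW₁f : ∀ v, W₁f v = ∑ b : ↥(pbox (fine Lc M')) × Fin (3 + 1), (hv v) b •
        Matrix.of (fun (b' : ↥(pbox (fine Lc M')) × Fin (3 + 1)) (e : Res (ctr (3 + 1) Lc) Lc M' ⊕ Res (ctr (3 + 1) Lc) Lc (fine Lc M')) =>
          if b' = b then
            -((((Lc : ℝ) ^ (3 + 1) * stepScale 3 Lc 0)⁻¹)
              * Sum.elim (fun t : Res (ctr (3 + 1) Lc) Lc M' => tdelta M' (quo Lc ((b.1 : Site (3 + 1)) + unitVec b.2)) t.1)
                  (fun s : Res (ctr (3 + 1) Lc) Lc (fine Lc M') => tdelta (fine Lc M') ((b.1 : Site (3 + 1)) + unitVec b.2) s.1) e)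
          else 0))
    (Db₁f : V → Matrix (↥(pbox M') × Fin (3 + 1)) (Res (ctr (3 + 1) Lc) Lc M') ℝ)
    (hDb₁f : ∀ v, Db₁f v = ∑ b : ↥(pbox (fine Lc M')) × Fin (3 + 1), (hv v) b •
        Matrix.of fun (a : ↥(pbox M') × Fin (3 + 1)) (t : Res (ctr (3 + 1) Lc) Lc M') =>
          -((((Lc : ℝ) ^ (3 + 1) * stepScale 3 Lc 0)⁻¹) * Q₁₀ a b * tdelta M' ((a.1 : Site (3 + 1)) + unitVec a.2) t.1))
    (W₂f : V → Matrix (↥(pbox (fine Lc M')) × Fin (3 + 1)) (Res (ctr (3 + 1) Lc) Lc M' ⊕ Res (ctr (3 + 1) Lc) Lc (fine Lc M')) ℝ)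
    (hW₂f : ∀ v, W₂f v = Matrix.of fun (b : ↥(pbox (fine Lc M')) × Fin (3 + 1)) (e : Res (ctr (3 + 1) Lc) Lc M' ⊕ Res (ctr (3 + 1) Lc) Lc (fine Lc M')) =>
        ((((Lc : ℝ) ^ (3 + 1) * stepScale 3 Lc 0)⁻¹) * (hv v) b) ^ 2 * Sum.elim (fun t : Res (ctr (3 + 1) Lc) Lc M' => tdelta M' (quo Lc ((b.1 : Site (3 + 1)) + unitVec b.2)) t.1)
          (fun s : Res (ctr (3 + 1) Lc) Lc (fine Lc M') => tdelta (fine Lc M') ((b.1 : Site (3 + 1)) + unitVec b.2) s.1) e)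
    (H₁f : V → Matrix (↥(pbox (fine Lc M')) × Fin (3 + 1)) (↥(pbox (fine Lc M')) × Fin (3 + 1)) ℝ)
    (hH₁f : ∀ v, H₁f v = ((-2 : ℝ) * (((Lc : ℝ) ^ (3 + 1) * stepScale 3 Lc 0)⁻¹)) • (∑ b : ↥(pbox (fine Lc M')) × Fin (3 + 1), (hv v) b •
        (perF (fine Lc M') (dper (fine Lc M') (wilsonA 3 b.2 (b.1 : Site (3 + 1))))).submatrix
          (fun b : ↥(pbox (fine Lc M')) × Fin (3 + 1) => ((b.1, Sum.inl b.2) : Idx (fine Lc M') (Fib 3)))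
          (fun b : ↥(pbox (fine Lc M')) × Fin (3 + 1) => ((b.1, Sum.inl b.2) : Idx (fine Lc M') (Fib 3))))
      + ∑ b : ↥(pbox (fine Lc M')) × Fin (3 + 1), (hv v) b •
        (w • (perF (fine Lc M') (dper (fine Lc M')
            (SLam Lc (lamCoeffOf (KInv (N := Lc) (d := 3)) Lc) (symHessFFAt (ctr (3 + 1) Lc) Lc) b.2 (b.1 : Site (3 + 1))))).submatrix
          (fun b : ↥(pbox (fine Lc M')) × Fin (3 + 1) => ((b.1, Sum.inl b.2) : Idx (fine Lc M') (Fib 3)))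
          (fun b : ↥(pbox (fine Lc M')) × Fin (3 + 1) => ((b.1, Sum.inl b.2) : Idx (fine Lc M') (Fib 3)))))
    (H'₁f : V → Matrix (↥(pbox (fine Lc M')) × Fin (3 + 1)) (↥(pbox (fine Lc M')) × Fin (3 + 1)) ℝ)
    (hH'₁f : ∀ v, H'₁f v = ((-2 : ℝ) * (((Lc : ℝ) ^ (3 + 1) * stepScale 3 Lc 0)⁻¹)) • (∑ b : ↥(pbox (fine Lc M')) × Fin (3 + 1),
        ((hv v) b + ∑ s : ↥(pbox (fine Lc M')), tgrad (fine Lc M') (b.1, Sum.inl b.2) s * (lv v) s) •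
          (perF (fine Lc M') (dper (fine Lc M') (wilsonA 3 b.2 (b.1 : Site (3 + 1))))).submatrix
          (fun b : ↥(pbox (fine Lc M')) × Fin (3 + 1) => ((b.1, Sum.inl b.2) : Idx (fine Lc M') (Fib 3)))
          (fun b : ↥(pbox (fine Lc M')) × Fin (3 + 1) => ((b.1, Sum.inl b.2) : Idx (fine Lc M') (Fib 3))))
      + ∑ b : ↥(pbox (fine Lc M')) × Fin (3 + 1), ((hv v) b + ∑ s : ↥(pbox (fine Lc M')), tgrad (fine Lc M') (b.1, Sum.inl b.2) s * (lv v) s) •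
        (w • (perF (fine Lc M') (dper (fine Lc M')
            (SLam Lc (lamCoeffOf (KInv (N := Lc) (d := 3)) Lc) (symHessFFAt (ctr (3 + 1) Lc) Lc) b.2 (b.1 : Site (3 + 1))))).submatrix
          (fun b : ↥(pbox (fine Lc M')) × Fin (3 + 1) => ((b.1, Sum.inl b.2) : Idx (fine Lc M') (Fib 3)))
          (fun b : ↥(pbox (fine Lc M')) × Fin (3 + 1) => ((b.1, Sum.inl b.2) : Idx (fine Lc M') (Fib 3)))))
    (H₂f : V → V → Matrix (↥(pbox (fine Lc M')) × Fin (3 + 1)) (↥(pbox (fine Lc M')) × Fin (3 + 1)) ℝ)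
    (hH₂f : ∀ v v', H₂f v v' = ((-2 : ℝ) * (((Lc : ℝ) ^ (3 + 1) * stepScale 3 Lc 0)⁻¹)) ^ 2 •
        (∑ b : ↥(pbox (fine Lc M')) × Fin (3 + 1), ∑ b' : ↥(pbox (fine Lc M')) × Fin (3 + 1), ((hv v) b * (hv v') b') •
          (perF (fine Lc M') (dper (fine Lc M') (W b'.2 (b'.1 : Site (3 + 1)) b.2 (b.1 : Site (3 + 1))))).submatrix
            (fun c : ↥(pbox (fine Lc M')) × Fin (3 + 1) => ((c.1, Sum.inl c.2) : Idx (fine Lc M') (Fib 3)))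
            (fun c : ↥(pbox (fine Lc M')) × Fin (3 + 1) => ((c.1, Sum.inl c.2) : Idx (fine Lc M') (Fib 3)))))
    (H'₂f : V → V → Matrix (↥(pbox (fine Lc M')) × Fin (3 + 1)) (↥(pbox (fine Lc M')) × Fin (3 + 1)) ℝ)
    (hH'₂f : ∀ v v', H'₂f v v' = ((-2 : ℝ) * (((Lc : ℝ) ^ (3 + 1) * stepScale 3 Lc 0)⁻¹)) ^ 2 •
        (∑ b : ↥(pbox (fine Lc M')) × Fin (3 + 1), ∑ b' : ↥(pbox (fine Lc M')) × Fin (3 + 1),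
          (((hv v) b + ∑ s : ↥(pbox (fine Lc M')), tgrad (fine Lc M') (b.1, Sum.inl b.2) s * (lv v) s)
            * ((hv v') b' + ∑ s : ↥(pbox (fine Lc M')), tgrad (fine Lc M') (b'.1, Sum.inl b'.2) s * (lv v') s)) •
          (perF (fine Lc M') (dper (fine Lc M') (W b'.2 (b'.1 : Site (3 + 1)) b.2 (b.1 : Site (3 + 1))))).submatrix
            (fun c : ↥(pbox (fine Lc M')) × Fin (3 + 1) => ((c.1, Sum.inl c.2) : Idx (fine Lc M') (Fib 3)))
            (fun c : ↥(pbox (fine Lc M')) × Fin (3 + 1) => ((c.1, Sum.inl c.2) : Idx (fine Lc M') (Fib 3))))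
      + ((-2 : ℝ) * (((Lc : ℝ) ^ (3 + 1) * stepScale 3 Lc 0)⁻¹)) •
        ((∑ b : ↥(pbox (fine Lc M')) × Fin (3 + 1), (hv v) b •
            (w • (perF (fine Lc M') (dper (fine Lc M')
              (SLam Lc (lamCoeffOf (KInv (N := Lc) (d := 3)) Lc) (symHessFFAt (ctr (3 + 1) Lc) Lc) b.2 (b.1 : Site (3 + 1))))).submatrix
            (fun b : ↥(pbox (fine Lc M')) × Fin (3 + 1) => ((b.1, Sum.inl b.2) : Idx (fine Lc M') (Fib 3)))
            (fun b : ↥(pbox (fine Lc M')) × Fin (3 + 1) => ((b.1, Sum.inl b.2) : Idx (fine Lc M') (Fib 3)))))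
          * Matrix.diagonal (fun b : ↥(pbox (fine Lc M')) × Fin (3 + 1) => (lv v') b.1)
        - Matrix.diagonal (fun b : ↥(pbox (fine Lc M')) × Fin (3 + 1) => (lv v) b.1)
          * (∑ b : ↥(pbox (fine Lc M')) × Fin (3 + 1), (hv v') b •
            (w • (perF (fine Lc M') (dper (fine Lc M')
              (SLam Lc (lamCoeffOf (KInv (N := Lc) (d := 3)) Lc) (symHessFFAt (ctr (3 + 1) Lc) Lc) b.2 (b.1 : Site (3 + 1))))).submatrix
            (fun b : ↥(pbox (fine Lc M')) × Fin (3 + 1) => ((b.1, Sum.inl b.2) : Idx (fine Lc M') (Fib 3)))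
            (fun b : ↥(pbox (fine Lc M')) × Fin (3 + 1) => ((b.1, Sum.inl b.2) : Idx (fine Lc M') (Fib 3)))))))
    (𝔔'₁f : V → Matrix κ (↥(pbox (fine Lc M')) × Fin (3 + 1)) ℝ)
    (h𝔔'₁f : ∀ v, 𝔔'₁f v = Q₂₁ (fun b => (hv v) b + ∑ s : ↥(pbox (fine Lc M')), tgrad (fine Lc M') (b.1, Sum.inl b.2) s * (lv v) s) * Q₁₀
        + Q₂₀ * Q₁₁ (fun b => (hv v) b + ∑ s : ↥(pbox (fine Lc M')), tgrad (fine Lc M') (b.1, Sum.inl b.2) s * (lv v) s))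
    -- the order-2 AVERAGING bindings DISPLAYED as bilinear maps (R-FP-63 (iv)): the one-shot naming `𝔔′₂` on the diagonal = I-7's `h𝔔'₂` left side
    (NY₂f : V → V → Matrix κ (↥(pbox (fine Lc M')) × Fin (3 + 1)) ℝ)
    (hNY₂d : ∀ v, NY₂f v v = Q₂₂ (fun b => (hv v) b + ∑ s : ↥(pbox (fine Lc M')), tgrad (fine Lc M') (b.1, Sum.inl b.2) s * (lv v) s) (fun b => (hv v) b + ∑ s : ↥(pbox (fine Lc M')), tgrad (fine Lc M') (b.1, Sum.inl b.2) s * (lv v) s) * Q₁₀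
        + Q₂₁ (fun b => (hv v) b + ∑ s : ↥(pbox (fine Lc M')), tgrad (fine Lc M') (b.1, Sum.inl b.2) s * (lv v) s) * Q₁₁ (fun b => (hv v) b + ∑ s : ↥(pbox (fine Lc M')), tgrad (fine Lc M') (b.1, Sum.inl b.2) s * (lv v) s)
        + (Q₂₁ (fun b => (hv v) b + ∑ s : ↥(pbox (fine Lc M')), tgrad (fine Lc M') (b.1, Sum.inl b.2) s * (lv v) s) * Q₁₁ (fun b => (hv v) b + ∑ s : ↥(pbox (fine Lc M')), tgrad (fine Lc M') (b.1, Sum.inl b.2) s * (lv v) s)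
          + Q₂₀ * Q₁₂ (fun b => (hv v) b + ∑ s : ↥(pbox (fine Lc M')), tgrad (fine Lc M') (b.1, Sum.inl b.2) s * (lv v) s) (fun b => (hv v) b + ∑ s : ↥(pbox (fine Lc M')), tgrad (fine Lc M') (b.1, Sum.inl b.2) s * (lv v) s)))
    (hNY₂l : ∀ (c : ℝ) (x y z : V), NY₂f (c • x + y) z = c • NY₂f x z + NY₂f y z)
    (hNY₂r : ∀ (c : ℝ) (x y z : V), NY₂f x (c • y + z) = c • NY₂f x y + NY₂f x z)
    (hQ₂₂l : ∀ (c : ℝ) (x y z : ↥(pbox (fine Lc M')) × Fin (3 + 1) → ℝ), Q₂₂ (c • x + y) z = c • Q₂₂ x z + Q₂₂ y z)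
    (hQ₂₂r : ∀ (c : ℝ) (x y z : ↥(pbox (fine Lc M')) × Fin (3 + 1) → ℝ), Q₂₂ x (c • y + z) = c • Q₂₂ x y + Q₂₂ x z)
    -- THE COMPANION PAIR (R-FP-59 ∕ I-7): the (Δ1) order-1 coarse companion `Λ₁` as a LINEAR function of the direction, ANTISYMMETRIC along every
    -- direction (I-7's graded parity `hΛ₁t`); the order-2 direction companion `N₂c` DISPLAYED as a bilinear map whose DIAGONAL is I-7's (Δ2) letter
    -- `C₁ = −(Q₁₁h)ᵀΛ₁Q₁₀ − (Q₁₁h)ᵀΛ₁Q₁₀ + Q₁₀ᵀΛ₁Q₁₁h + Q₁₀ᵀΛ₁Q₁₁h` plus the two graded commutators `(Q₁₀ᵀΛ₁Q₁₀)X − Xᵀ(Q₁₀ᵀΛ₁Q₁₀)` (I-7's conclusion, `X` the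
    -- pinned diagonal generator); the order-2 coarse companion `Λ₂` rides in the FREE symmetric coarse family `EC` (below), the free `G` in `EF`
    (Λ₁f : V → Matrix (↥(pbox M') × Fin (3 + 1)) (↥(pbox M') × Fin (3 + 1)) ℝ)
    (hΛ₁l : ∀ (c : ℝ) (x y : V), Λ₁f (c • x + y) = c • Λ₁f x + Λ₁f y) (hΛ₁t : ∀ v : V, (Λ₁f v)ᵀ = -Λ₁f v)
    (N₂cf : V → V → Matrix (↥(pbox (fine Lc M')) × Fin (3 + 1)) (↥(pbox (fine Lc M')) × Fin (3 + 1)) ℝ)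
    (hN₂cd : ∀ v : V, N₂cf v v = ((-((Q₁₁ (hv v))ᵀ * (Λ₁f v) * Q₁₀) - (Q₁₁ (hv v))ᵀ * (Λ₁f v) * Q₁₀ + Q₁₀ᵀ * (Λ₁f v) * Q₁₁ (hv v) + Q₁₀ᵀ * (Λ₁f v) * Q₁₁ (hv v)) + ((Q₁₀ᵀ * (Λ₁f v) * Q₁₀) * (-((((Lc : ℝ) ^ (3 + 1) * stepScale 3 Lc 0)⁻¹) • Matrix.diagonal (fun b : ↥(pbox (fine Lc M')) × Fin (3 + 1) => (lv v) b.1))) + -((-((((Lc : ℝ) ^ (3 + 1) * stepScale 3 Lc 0)⁻¹) • Matrix.diagonal (fun b : ↥(pbox (fine Lc M')) × Fin (3 + 1) => (lv v) b.1)))ᵀ * (Q₁₀ᵀ * (Λ₁f v) * Q₁₀))) + ((Q₁₀ᵀ * (Λ₁f v) * Q₁₀) * (-((((Lc : ℝ) ^ (3 + 1) * stepScale 3 Lc 0)⁻¹) • Matrix.diagonal (fun b : ↥(pbox (fine Lc M')) × Fin (3 + 1) => (lv v) b.1))) + -((-((((Lc : ℝ) ^ (3 + 1) * stepScale 3 Lc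 0)⁻¹) • Matrix.diagonal (fun b : ↥(pbox (fine Lc M')) × Fin (3 + 1) => (lv v) b.1)))ᵀ * (Q₁₀ᵀ * (Λ₁f v) * Q₁₀)))))
    (hN₂cl : ∀ (c : ℝ) (x y z : V), N₂cf (c • x + y) z = c • N₂cf x z + N₂cf y z)
    (hN₂cr : ∀ (c : ℝ) (x y z : V), N₂cf x (c • y + z) = c • N₂cf x y + N₂cf x z)
    -- I-7's displayed ROWS `hdead a1 a2` (total jets), for EVERY direction (free witnesses as functions of the direction and of the free pair)
    (Y₁f : V → Matrix κ (Res (ctr (3 + 1) Lc) Lc M' ⊕ Res (ctr (3 + 1) Lc) Lc (fine Lc M')) ℝ)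
    (Y₂f : V → Matrix (↥(pbox (fine Lc M')) × Fin (3 + 1)) (↥(pbox (fine Lc M')) × Fin (3 + 1)) ℝ → Matrix (↥(pbox M') × Fin (3 + 1)) (↥(pbox M') × Fin (3 + 1)) ℝ → Matrix κ (Res (ctr (3 + 1) Lc) Lc M' ⊕ Res (ctr (3 + 1) Lc) Lc (fine Lc M')) ℝ)
    (hdead : ∀ v : V, ∀ (a : ↥(pbox M') × Fin (3 + 1)) (x : Res (ctr (3 + 1) Lc) Lc M'),
      combBondT (ctr (3 + 1) Lc) Lc M' x = ((a.1, Sum.inl a.2) : Idx M' (Fib 3)) → ∑ b : ↥(pbox (fine Lc M')) × Fin (3 + 1), Q₁₀ a b * (hv v) b = 0)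
    (a1 : ∀ v : V, ((H₁f v) + (Q₁₀ᵀ * (Λ₁f v) * Q₁₀)) * fromCols D₂ D₁ + H₀ * (W₁f v) = 𝔔₀ᵀ * (Y₁f v))
    (a2 : ∀ (v : V) (EF' : Matrix (↥(pbox (fine Lc M')) × Fin (3 + 1)) (↥(pbox (fine Lc M')) × Fin (3 + 1)) ℝ) (EC' : Matrix (↥(pbox M') × Fin (3 + 1)) (↥(pbox M') × Fin (3 + 1)) ℝ), ((H₂f v v + EF') + (-((Q₁₁ (hv v))ᵀ * (Λ₁f v) * Q₁₀) - (Q₁₁ (hv v))ᵀ * (Λ₁f v) * Q₁₀ + Q₁₀ᵀ * EC' * Q₁₀ + Q₁₀ᵀ * (Λ₁f v) * Q₁₁ (hv v) + Q₁₀ᵀ * (Λ₁f v) * Q₁₁ (hv v))) * fromCols D₂ D₁ + (2 : ℝ) • (((H₁f v) + (Q₁₀ᵀ * (Λ₁f v) * Q₁₀)) * (W₁f v)) + H₀ * (W₂f v)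
      = -((2 : ℝ) • ((Q₂₁ (hv v) * Q₁₀ + Q₂₀ * Q₁₁ (hv v))ᵀ * (Y₁f v))) + 𝔔₀ᵀ * (Y₂f v EF' EC'))
    -- right inverses of the three base systems (leaf-05's `RelInvPeriodised*` letters supply them at the record)
    {XN : Matrix ((↥(pbox (fine Lc M')) × Fin (3 + 1)) ⊕ (κ ⊕ (Res (ctr (3 + 1) Lc) Lc M' ⊕ Res (ctr (3 + 1) Lc) Lc (fine Lc M')))) ((↥(pbox (fine Lc M')) × Fin (3 + 1)) ⊕ (κ ⊕ (Res (ctr (3 + 1) Lc) Lc M' ⊕ Res (ctr (3 + 1) Lc) Lc (fine Lc M')))) ℝ} (hXN : kkt H₀ (fromRows 𝔔₀ P) * XN = 1)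
    {XF : Matrix ((↥(pbox (fine Lc M')) × Fin (3 + 1)) ⊕ ((↥(pbox M') × Fin (3 + 1)) ⊕ Res (ctr (3 + 1) Lc) Lc (fine Lc M'))) ((↥(pbox (fine Lc M')) × Fin (3 + 1)) ⊕ ((↥(pbox M') × Fin (3 + 1)) ⊕ Res (ctr (3 + 1) Lc) Lc (fine Lc M'))) ℝ} (hXF : kkt H₀ (fromRows Q₁₀ τ₁) * XF = 1)
    {XG : Matrix ((↥(pbox M') × Fin (3 + 1)) ⊕ (κ ⊕ Res (ctr (3 + 1) Lc) Lc M')) ((↥(pbox M') × Fin (3 + 1)) ⊕ (κ ⊕ Res (ctr (3 + 1) Lc) Lc M')) ℝ} (hXG : kkt S.toBlocks₁₁ (fromRows Q₂₀ τ₂) * XG = 1)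
    {σ : Type*} [Fintype σ] [DecidableEq σ] (d : σ → V) (EF : σ → σ → Matrix (↥(pbox (fine Lc M')) × Fin (3 + 1)) (↥(pbox (fine Lc M')) × Fin (3 + 1)) ℝ) (hEFs : ∀ k l, EF k l = EF l k) (hEFt : ∀ k l, (EF k l)ᵀ = EF l k)
    (EC : σ → σ → Matrix (↥(pbox M') × Fin (3 + 1)) (↥(pbox M') × Fin (3 + 1)) ℝ) (hECs : ∀ k l, EC k l = EC l k) (hECt : ∀ k l, (EC k l)ᵀ = EC l k) (k l : σ) :
    hessT (XN.submatrix (Sum.map id Sum.inl) (Sum.map id Sum.inl))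
        (fromBlocks (H'₁f (d k) + Q₁₀ᵀ * Λ₁f (d k) * Q₁₀) (-(𝔔'₁f (d k))ᵀ) (𝔔'₁f (d k)) 0)
        (fromBlocks (H'₁f (d l) + Q₁₀ᵀ * Λ₁f (d l) * Q₁₀) (-(𝔔'₁f (d l))ᵀ) (𝔔'₁f (d l)) 0)
        (kkt ((1 / 2 : ℝ) • ((H'₂f (d k) (d l) + N₂cf (d k) (d l)) + (H'₂f (d l) (d k) + N₂cf (d l) (d k))) + (EF k l + Q₁₀ᵀ * EC k l * Q₁₀))
          ((1 / 2 : ℝ) • (NY₂f (d k) (d l) + NY₂f (d l) (d k))))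
      = hessT (XF.submatrix (Sum.map id Sum.inl) (Sum.map id Sum.inl))
          (fromBlocks (H₁f (d k)) (-(Q₁₁ (hv (d k)))ᵀ) (Q₁₁ (hv (d k))) 0)
          (fromBlocks (H₁f (d l)) (-(Q₁₁ (hv (d l)))ᵀ) (Q₁₁ (hv (d l))) 0)
          (kkt ((1 / 2 : ℝ) • (H₂f (d k) (d l) + H₂f (d l) (d k)) + EF k l)
            ((1 / 2 : ℝ) • (Q₁₂ (hv (d k)) (hv (d l)) + Q₁₂ (hv (d l)) (hv (d k)))))
        + hessT (XG.submatrix (Sum.map id Sum.inl) (Sum.map id Sum.inl))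
          (fromBlocks ((((L * (H₁f (d k)) - S * (fromRows (Q₁₁ (hv (d k))) (0 : Matrix (Res (ctr (3 + 1) Lc) Lc (fine Lc M')) (↥(pbox (fine Lc M')) × Fin (3 + 1)) ℝ))) * I + L * (fromRows (Q₁₁ (hv (d k))) (0 : Matrix (Res (ctr (3 + 1) Lc) Lc (fine Lc M')) (↥(pbox (fine Lc M')) × Fin (3 + 1)) ℝ))ᵀ * S)).toBlocks₁₁ + Λ₁f (d k)) (-(Q₂₁ (hv (d k)))ᵀ) (Q₂₁ (hv (d k))) 0)
          (fromBlocks ((((L * (H₁f (d l)) - S * (fromRows (Q₁₁ (hv (d l))) (0 : Matrix (Res (ctr (3 + 1) Lc) Lc (fine Lc M')) (↥(pbox (fine Lc M')) × Fin (3 + 1)) ℝ))) * I + L * (fromRows (Q₁₁ (hv (d l))) (0 : Matrix (Res (ctr (3 + 1) Lc) Lc (fine Lc M')) (↥(pbox (fine Lc M')) × Fin (3 + 1)) ℝ))ᵀ * S)).toBlocks₁₁ + Λ₁f (d l)) (-(Q₂₁ (hv (d l)))ᵀ) (Q₂₁ (hv (d l))) 0)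
          (kkt ((1 / 2 : ℝ) • ((((((-((L * (H₁f (d k)) - S * (fromRows (Q₁₁ (hv (d k))) (0 : Matrix (Res (ctr (3 + 1) Lc) Lc (fine Lc M')) (↥(pbox (fine Lc M')) × Fin (3 + 1)) ℝ))) * Γ - L * (fromRows (Q₁₁ (hv (d k))) (0 : Matrix (Res (ctr (3 + 1) Lc) Lc (fine Lc M')) (↥(pbox (fine Lc M')) × Fin (3 + 1)) ℝ))ᵀ * L) * (H₁f (d l)) + L * (H₂f (d k) (d l))
          - (((L * (H₁f (d k)) - S * (fromRows (Q₁₁ (hv (d k))) (0 : Matrix (Res (ctr (3 + 1) Lc) Lc (fine Lc M')) (↥(pbox (fine Lc M')) × Fin (3 + 1)) ℝ))) * I + L * (fromRows (Q₁₁ (hv (d k))) (0 : Matrix (Res (ctr (3 + 1) Lc) Lc (fine Lc M')) (↥(pbox (fine Lc M')) × Fin (3 + 1)) ℝ))ᵀ * S) * (fromRows (Q₁₁ (hv (d l))) (0 : Matrix (Res (ctr (3 + 1) Lc) Lc (fine Lc M')) (↥(pbox (fine Lc M')) × Fin (3 + 1)) ℝ)) + S * (fromRows (Q₁₂ (hv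 (d k)) (hv (d l))) (0 : Matrix (Res (ctr (3 + 1) Lc) Lc (fine Lc M')) (↥(pbox (fine Lc M')) × Fin (3 + 1)) ℝ)))) * I
        + (L * (H₁f (d k)) - S * (fromRows (Q₁₁ (hv (d k))) (0 : Matrix (Res (ctr (3 + 1) Lc) Lc (fine Lc M')) (↥(pbox (fine Lc M')) × Fin (3 + 1)) ℝ))) * (-((Γ * (H₁f (d l)) + I * (fromRows (Q₁₁ (hv (d l))) (0 : Matrix (Res (ctr (3 + 1) Lc) Lc (fine Lc M')) (↥(pbox (fine Lc M')) × Fin (3 + 1)) ℝ))) * I + Γ * (fromRows (Q₁₁ (hv (d l))) (0 : Matrix (Res (ctr (3 + 1) Lc) Lc (fine Lc M')) (↥(pbox (fine Lc M')) × Fin (3 + 1)) ℝ))ᵀ * S)))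
      - ((-((L * (H₁f (d k)) - S * (fromRows (Q₁₁ (hv (d k))) (0 : Matrix (Res (ctr (3 + 1) Lc) Lc (fine Lc M')) (↥(pbox (fine Lc M')) × Fin (3 + 1)) ℝ))) * Γ - L * (fromRows (Q₁₁ (hv (d k))) (0 : Matrix (Res (ctr (3 + 1) Lc) Lc (fine Lc M')) (↥(pbox (fine Lc M')) × Fin (3 + 1)) ℝ))ᵀ * L) * (-(fromRows (Q₁₁ (hv (d l))) (0 : Matrix (Res (ctr (3 + 1) Lc) Lc (fine Lc M')) (↥(pbox (fine Lc M')) × Fin (3 + 1)) ℝ))ᵀ) + L * (fromRows (Q₁₂ (hv (d k)) (hv (d l))) (0 : Matrix (Res (ctr (3 + 1) Lc) Lc (fine Lc M')) (↥(pbox (fine Lc M')) × Fin (3 + 1)) ℝ))ᵀ) * S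
          + L * (-(fromRows (Q₁₁ (hv (d k))) (0 : Matrix (Res (ctr (3 + 1) Lc) Lc (fine Lc M')) (↥(pbox (fine Lc M')) × Fin (3 + 1)) ℝ))ᵀ) * ((L * (H₁f (d l)) - S * (fromRows (Q₁₁ (hv (d l))) (0 : Matrix (Res (ctr (3 + 1) Lc) Lc (fine Lc M')) (↥(pbox (fine Lc M')) × Fin (3 + 1)) ℝ))) * I + L * (fromRows (Q₁₁ (hv (d l))) (0 : Matrix (Res (ctr (3 + 1) Lc) Lc (fine Lc M')) (↥(pbox (fine Lc M')) × Fin (3 + 1)) ℝ))ᵀ * S)))).toBlocks₁₁ + (0 : Matrix (↥(pbox M') × Fin (3 + 1)) (↥(pbox M') × Fin (3 + 1)) ℝ)) + (((((-((L * (H₁f (d l)) - S * (fromRows (Q₁₁ (hv (d l))) (0 : Matrix (Res (ctr (3 + 1) Lc) Lc (fine Lc M')) (↥(pbox (fine Lc M')) × Fin (3 + 1)) ℝ))) * Γ - L * (fromRows (Q₁₁ (hv (d l))) (0 : Matrix (Res (ctr (3 + 1) Lc) Lc (fine Lc M')) (↥(pbox (fine Lc M')) × Fin (3 + 1)) ℝ))ᵀ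 * L) * (H₁f (d k)) + L * (H₂f (d l) (d k))
          - (((L * (H₁f (d l)) - S * (fromRows (Q₁₁ (hv (d l))) (0 : Matrix (Res (ctr (3 + 1) Lc) Lc (fine Lc M')) (↥(pbox (fine Lc M')) × Fin (3 + 1)) ℝ))) * I + L * (fromRows (Q₁₁ (hv (d l))) (0 : Matrix (Res (ctr (3 + 1) Lc) Lc (fine Lc M')) (↥(pbox (fine Lc M')) × Fin (3 + 1)) ℝ))ᵀ * S) * (fromRows (Q₁₁ (hv (d k))) (0 : Matrix (Res (ctr (3 + 1) Lc) Lc (fine Lc M')) (↥(pbox (fine Lc M')) × Fin (3 + 1)) ℝ)) + S * (fromRows (Q₁₂ (hv (d l)) (hv (d k))) (0 : Matrix (Res (ctr (3 + 1) Lc) Lc (fine Lc M')) (↥(pbox (fine Lc M')) × Fin (3 + 1)) ℝ)))) * I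
        + (L * (H₁f (d l)) - S * (fromRows (Q₁₁ (hv (d l))) (0 : Matrix (Res (ctr (3 + 1) Lc) Lc (fine Lc M')) (↥(pbox (fine Lc M')) × Fin (3 + 1)) ℝ))) * (-((Γ * (H₁f (d k)) + I * (fromRows (Q₁₁ (hv (d k))) (0 : Matrix (Res (ctr (3 + 1) Lc) Lc (fine Lc M')) (↥(pbox (fine Lc M')) × Fin (3 + 1)) ℝ))) * I + Γ * (fromRows (Q₁₁ (hv (d k))) (0 : Matrix (Res (ctr (3 + 1) Lc) Lc (fine Lc M')) (↥(pbox (fine Lc M')) × Fin (3 + 1)) ℝ))ᵀ * S)))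
      - ((-((L * (H₁f (d l)) - S * (fromRows (Q₁₁ (hv (d l))) (0 : Matrix (Res (ctr (3 + 1) Lc) Lc (fine Lc M')) (↥(pbox (fine Lc M')) × Fin (3 + 1)) ℝ))) * Γ - L * (fromRows (Q₁₁ (hv (d l))) (0 : Matrix (Res (ctr (3 + 1) Lc) Lc (fine Lc M')) (↥(pbox (fine Lc M')) × Fin (3 + 1)) ℝ))ᵀ * L) * (-(fromRows (Q₁₁ (hv (d k))) (0 : Matrix (Res (ctr (3 + 1) Lc) Lc (fine Lc M')) (↥(pbox (fine Lc M')) × Fin (3 + 1)) ℝ))ᵀ) + L * (fromRows (Q₁₂ (hv (d l)) (hv (d k))) (0 : Matrix (Res (ctr (3 + 1) Lc) Lc (fine Lc M')) (↥(pbox (fine Lc M')) × Fin (3 + 1)) ℝ))ᵀ) * S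
          + L * (-(fromRows (Q₁₁ (hv (d l))) (0 : Matrix (Res (ctr (3 + 1) Lc) Lc (fine Lc M')) (↥(pbox (fine Lc M')) × Fin (3 + 1)) ℝ))ᵀ) * ((L * (H₁f (d k)) - S * (fromRows (Q₁₁ (hv (d k))) (0 : Matrix (Res (ctr (3 + 1) Lc) Lc (fine Lc M')) (↥(pbox (fine Lc M')) × Fin (3 + 1)) ℝ))) * I + L * (fromRows (Q₁₁ (hv (d k))) (0 : Matrix (Res (ctr (3 + 1) Lc) Lc (fine Lc M')) (↥(pbox (fine Lc M')) × Fin (3 + 1)) ℝ))ᵀ * S)))).toBlocks₁₁ + (0 : Matrix (↥(pbox M') × Fin (3 + 1)) (↥(pbox M') × Fin (3 + 1)) ℝ)))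
                + ((L * EF k l * I).toBlocks₁₁ + EC k l))
            ((1 / 2 : ℝ) • (Q₂₂ (hv (d k)) (hv (d l)) + Q₂₂ (hv (d l)) (hv (d k))))) := by
  have hzbC : ∀ (c : ℝ) (x y z : V), (fun _ _ : V => (0 : Matrix (↥(pbox M') × Fin (3 + 1)) (↥(pbox M') × Fin (3 + 1)) ℝ)) (c • x + y) z = c • (fun _ _ : V => (0 : Matrix (↥(pbox M') × Fin (3 + 1)) (↥(pbox M') × Fin (3 + 1)) ℝ)) x z + (fun _ _ : V => (0 : Matrix (↥(pbox M') × Fin (3 + 1)) (↥(pbox M') × Fin (3 + 1)) ℝ)) y z := by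
    intros; simp
  have hzbC' : ∀ (c : ℝ) (x y z : V), (fun _ _ : V => (0 : Matrix (↥(pbox M') × Fin (3 + 1)) (↥(pbox M') × Fin (3 + 1)) ℝ)) x (c • y + z) = c • (fun _ _ : V => (0 : Matrix (↥(pbox M') × Fin (3 + 1)) (↥(pbox M') × Fin (3 + 1)) ℝ)) x y + (fun _ _ : V => (0 : Matrix (↥(pbox M') × Fin (3 + 1)) (↥(pbox M') × Fin (3 + 1)) ℝ)) x z := by
    intros; simp
  refine Summit.QuantumFields.BalabanUV.Beta.FP.LevelZeroDoorShapes.hessT_law_of_mixedVar_law _ _ _ _ _ _ _ _ _ _ _ _ _ _ _ _ _ _ ?_ hXN hXF hXG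
  exact mixedVar_kernel_law_of_levelZero_door hv lv hhv hlv
    ((-2 : ℝ) * (((Lc : ℝ) ^ (3 + 1) * stepScale 3 Lc 0)⁻¹)) w (-(((Lc : ℝ) ^ (3 + 1) * stepScale 3 Lc 0)⁻¹)) (fun (b : ↥(pbox (fine Lc M')) × Fin (3 + 1)) (s : ↥(pbox (fine Lc M'))) => tgrad (fine Lc M') (b.1, Sum.inl b.2) s) (fun b : ↥(pbox (fine Lc M')) × Fin (3 + 1) => b.1)
    (fun b : ↥(pbox (fine Lc M')) × Fin (3 + 1) => (perF (fine Lc M') (dper (fine Lc M') (wilsonA 3 b.2 (b.1 : Site (3 + 1))))).submatrix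
          (fun b : ↥(pbox (fine Lc M')) × Fin (3 + 1) => ((b.1, Sum.inl b.2) : Idx (fine Lc M') (Fib 3)))
          (fun b : ↥(pbox (fine Lc M')) × Fin (3 + 1) => ((b.1, Sum.inl b.2) : Idx (fine Lc M') (Fib 3))))
    (fun b : ↥(pbox (fine Lc M')) × Fin (3 + 1) => (perF (fine Lc M') (dper (fine Lc M')
            (SLam Lc (lamCoeffOf (KInv (N := Lc) (d := 3)) Lc) (symHessFFAt (ctr (3 + 1) Lc) Lc) b.2 (b.1 : Site (3 + 1))))).submatrix
          (fun b : ↥(pbox (fine Lc M')) × Fin (3 + 1) => ((b.1, Sum.inl b.2) : Idx (fine Lc M') (Fib 3)))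
          (fun b : ↥(pbox (fine Lc M')) × Fin (3 + 1) => ((b.1, Sum.inl b.2) : Idx (fine Lc M') (Fib 3))))
    (fun b b' : ↥(pbox (fine Lc M')) × Fin (3 + 1) => (perF (fine Lc M') (dper (fine Lc M') (W b'.2 (b'.1 : Site (3 + 1)) b.2 (b.1 : Site (3 + 1))))).submatrix
            (fun c : ↥(pbox (fine Lc M')) × Fin (3 + 1) => ((c.1, Sum.inl c.2) : Idx (fine Lc M') (Fib 3)))
            (fun c : ↥(pbox (fine Lc M')) × Fin (3 + 1) => ((c.1, Sum.inl c.2) : Idx (fine Lc M') (Fib 3))))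
    (fun b : ↥(pbox (fine Lc M')) × Fin (3 + 1) => (perF (fine Lc M') (dper (fine Lc M') (symVhSAt (ctr (3 + 1) Lc) 3 Lc rfl b.2 (b.1 : Site (3 + 1))))).submatrix
          (fun a : ↥(pbox M') × Fin (3 + 1) => ((coarsePt M' Lc a.1, Sum.inr a.2) : Idx (fine Lc M') (Fib 3)))
          (fun b : ↥(pbox (fine Lc M')) × Fin (3 + 1) => ((b.1, Sum.inl b.2) : Idx (fine Lc M') (Fib 3))))
    (fun b : ↥(pbox (fine Lc M')) × Fin (3 + 1) => ∑ a' : ↥(pbox M') × Fin (3 + 1), (stepScale 3 Lc 1 / (stepScale 3 Lc 0 ^ 2 * ((box (3 + 1) Lc).card : ℝ)) * Q₁₀ a' b) •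
          (perF M' (dper M' (symVhSAt (ctr (3 + 1) Lc) 3 Lc rfl a'.2 (a'.1 : Site (3 + 1))))).submatrix (fun a : κ => ((pμ' a, Sum.inr (mμ' a)) : Idx M' (Fib 3)))
            (fun b : ↥(pbox M') × Fin (3 + 1) => ((b.1, Sum.inl b.2) : Idx M' (Fib 3))))
    (fun b b' : ↥(pbox (fine Lc M')) × Fin (3 + 1) => (perF (fine Lc M') (dper (fine Lc M') (W₁₂ b'.2 (b'.1 : Site (3 + 1)) b.2 (b.1 : Site (3 + 1))))).submatrix
          (fun a : ↥(pbox M') × Fin (3 + 1) => ((coarsePt M' Lc a.1, Sum.inr a.2) : Idx (fine Lc M') (Fib 3)))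
          (fun c : ↥(pbox (fine Lc M')) × Fin (3 + 1) => ((c.1, Sum.inl c.2) : Idx (fine Lc M') (Fib 3))))
    Q₁₀ Q₂₀ Γ I L S (kkt H₀ (fromRows 𝔔₀ P)) (kkt H₀ (fromRows Q₁₀ τ₁)) (kkt S.toBlocks₁₁ (fromRows Q₂₀ τ₂))
    Q₁₁ hQ₁₁ Q₂₁ hQ₂₁ Q₁₂ hQ₁₂ H₁f hH₁f H'₁f hH'₁f H₂f hH₂f H'₂f hH'₂f 𝔔'₁f h𝔔'₁f
    (fun v => (((L * (H₁f v) - S * (fromRows (Q₁₁ (hv v)) (0 : Matrix (Res (ctr (3 + 1) Lc) Lc (fine Lc M')) (↥(pbox (fine Lc M')) × Fin (3 + 1)) ℝ))) * I + L * (fromRows (Q₁₁ (hv v)) (0 : Matrix (Res (ctr (3 + 1) Lc) Lc (fine Lc M')) (↥(pbox (fine Lc M')) × Fin (3 + 1)) ℝ))ᵀ * S)).toBlocks₁₁) (fun v => rfl)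
    (fun v v' => ((((-((L * (H₁f v) - S * (fromRows (Q₁₁ (hv v)) (0 : Matrix (Res (ctr (3 + 1) Lc) Lc (fine Lc M')) (↥(pbox (fine Lc M')) × Fin (3 + 1)) ℝ))) * Γ - L * (fromRows (Q₁₁ (hv v)) (0 : Matrix (Res (ctr (3 + 1) Lc) Lc (fine Lc M')) (↥(pbox (fine Lc M')) × Fin (3 + 1)) ℝ))ᵀ * L) * (H₁f v') + L * (H₂f v v')
          - (((L * (H₁f v) - S * (fromRows (Q₁₁ (hv v)) (0 : Matrix (Res (ctr (3 + 1) Lc) Lc (fine Lc M')) (↥(pbox (fine Lc M')) × Fin (3 + 1)) ℝ))) * I + L * (fromRows (Q₁₁ (hv v)) (0 : Matrix (Res (ctr (3 + 1) Lc) Lc (fine Lc M')) (↥(pbox (fine Lc M')) × Fin (3 + 1)) ℝ))ᵀ * S) * (fromRows (Q₁₁ (hv v')) (0 : Matrix (Res (ctr (3 + 1) Lc) Lc (fine Lc M')) (↥(pbox (fine Lc M')) × Fin (3 + 1)) ℝ)) + S * (fromRows (Q₁₂ (hv v) (hv v')) (0 : Matrix (Res (ctr (3 + 1) Lc) Lc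 (fine Lc M')) (↥(pbox (fine Lc M')) × Fin (3 + 1)) ℝ)))) * I
        + (L * (H₁f v) - S * (fromRows (Q₁₁ (hv v)) (0 : Matrix (Res (ctr (3 + 1) Lc) Lc (fine Lc M')) (↥(pbox (fine Lc M')) × Fin (3 + 1)) ℝ))) * (-((Γ * (H₁f v') + I * (fromRows (Q₁₁ (hv v')) (0 : Matrix (Res (ctr (3 + 1) Lc) Lc (fine Lc M')) (↥(pbox (fine Lc M')) × Fin (3 + 1)) ℝ))) * I + Γ * (fromRows (Q₁₁ (hv v')) (0 : Matrix (Res (ctr (3 + 1) Lc) Lc (fine Lc M')) (↥(pbox (fine Lc M')) × Fin (3 + 1)) ℝ))ᵀ * S)))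
      - ((-((L * (H₁f v) - S * (fromRows (Q₁₁ (hv v)) (0 : Matrix (Res (ctr (3 + 1) Lc) Lc (fine Lc M')) (↥(pbox (fine Lc M')) × Fin (3 + 1)) ℝ))) * Γ - L * (fromRows (Q₁₁ (hv v)) (0 : Matrix (Res (ctr (3 + 1) Lc) Lc (fine Lc M')) (↥(pbox (fine Lc M')) × Fin (3 + 1)) ℝ))ᵀ * L) * (-(fromRows (Q₁₁ (hv v')) (0 : Matrix (Res (ctr (3 + 1) Lc) Lc (fine Lc M')) (↥(pbox (fine Lc M')) × Fin (3 + 1)) ℝ))ᵀ) + L * (fromRows (Q₁₂ (hv v) (hv v')) (0 : Matrix (Res (ctr (3 + 1) Lc) Lc (fine Lc M')) (↥(pbox (fine Lc M')) × Fin (3 + 1)) ℝ))ᵀ) * S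
          + L * (-(fromRows (Q₁₁ (hv v)) (0 : Matrix (Res (ctr (3 + 1) Lc) Lc (fine Lc M')) (↥(pbox (fine Lc M')) × Fin (3 + 1)) ℝ))ᵀ) * ((L * (H₁f v') - S * (fromRows (Q₁₁ (hv v')) (0 : Matrix (Res (ctr (3 + 1) Lc) Lc (fine Lc M')) (↥(pbox (fine Lc M')) × Fin (3 + 1)) ℝ))) * I + L * (fromRows (Q₁₁ (hv v')) (0 : Matrix (Res (ctr (3 + 1) Lc) Lc (fine Lc M')) (↥(pbox (fine Lc M')) × Fin (3 + 1)) ℝ))ᵀ * S)))).toBlocks₁₁) (fun v v' => rfl)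
    (fun v : V => Q₁₀ᵀ * Λ₁f v * Q₁₀) (fun c x y => by simp only [hΛ₁l, Matrix.mul_add, Matrix.add_mul, Matrix.mul_smul, Matrix.smul_mul]) Λ₁f hΛ₁l
    N₂cf hN₂cl hN₂cr
    (fun _ _ => 0) hzbC hzbC'
    NY₂f hNY₂l hNY₂r (fun v v' : V => Q₂₂ (hv v) (hv v')) (fun c x y z => by simp only [hhv]; exact hQ₂₂l c (hv x) (hv y) (hv z))
    (fun c x y z => by simp only [hhv]; exact hQ₂₂r c (hv x) (hv y) (hv z))
    (fun e : Matrix (↥(pbox (fine Lc M')) × Fin (3 + 1)) (↥(pbox (fine Lc M')) × Fin (3 + 1)) ℝ × Matrix (↥(pbox M') × Fin (3 + 1)) (↥(pbox M') × Fin (3 + 1)) ℝ => e.1 + Q₁₀ᵀ * e.2 * Q₁₀) (fun e : Matrix (↥(pbox (fine Lc M')) × Fin (3 + 1)) (↥(pbox (fine Lc M')) × Fin (3 + 1)) ℝ × Matrix (↥(pbox M') × Fin (3 + 1)) (↥(pbox M') × Fin (3 + 1)) ℝ => e.1)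
    (fun e : Matrix (↥(pbox (fine Lc M')) × Fin (3 + 1)) (↥(pbox (fine Lc M')) × Fin (3 + 1)) ℝ × Matrix (↥(pbox M') × Fin (3 + 1)) (↥(pbox M') × Fin (3 + 1)) ℝ => e.2)
    (fun c x y => by
      simp only [Prod.fst_add, Prod.smul_fst, Prod.snd_add, Prod.smul_snd, Matrix.mul_add, Matrix.add_mul, Matrix.mul_smul, Matrix.smul_mul, smul_add]
      abel)
    (fun c x y => by simp only [Prod.fst_add, Prod.smul_fst]) (fun c x y => by simp only [Prod.snd_add, Prod.smul_snd])
    (fun e : Matrix (↥(pbox (fine Lc M')) × Fin (3 + 1)) (↥(pbox (fine Lc M')) × Fin (3 + 1)) ℝ × Matrix (↥(pbox M') × Fin (3 + 1)) (↥(pbox M') × Fin (3 + 1)) ℝ => e.1ᵀ = e.1 ∧ e.2ᵀ = e.2)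
    (fun v e he => by
      -- I-7 BY TERM at the direction `v`, the free fine `G := e.1`, the free coarse `Λ₂ := e.2`, the companion `Λ₁ := Λ₁f v`
      have h :=
        secondVar_oneShot_nestedStepLaw_torus_levelZero_door_companion M' hM' pμ' mμ' hfμ' hcoarse'
          hH₀ hQ₁₀ hτ₁ hτ₂ hD₁ hD₂ hDbar hP hQ₂₀ (hv v) (lv v) Q₁₁ hQ₁₁ Q₂₁ hQ₂₁ (hW₁f v) (hDb₁f v) w (hH₁f v) hN hW e.1 he.1
          (H₂ := H₂f v v + e.1) (by rw [hH₂f]) (hdead v) hW₁₂ Q₁₂ hQ₁₂ hW₂₂ Q₂₂ hQ₂₂ (hW₂f v) (Y₁f v) (Y₂f v e.1 e.2)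
          rfl rfl rfl rfl rfl h𝔔₀ rfl rfl (H'₂ := H'₂f v v + e.1) (by rw [hH'₂f]) (hH'₁f v) (h𝔔'₁f v).symm (hNY₂d v).symm
          (Λ₁f v) e.2 (hΛ₁t v) he.2 (a1 v) (a2 v e.1 e.2) hΓ hI hL hS rfl
      -- the one-shot second slot REGROUPED: I-7's `(H′₂ + G) + (C + [P,X] + [P,X])` = the socket's `H′₂ + N₂c v v + ΦN (G, Λ₂)`
      have eN : H'₂f v v + e.1 + ((-((Q₁₁ (hv v))ᵀ * (Λ₁f v) * Q₁₀) - (Q₁₁ (hv v))ᵀ * (Λ₁f v) * Q₁₀ + Q₁₀ᵀ * e.2 * Q₁₀ + Q₁₀ᵀ * (Λ₁f v) * Q₁₁ (hv v) + Q₁₀ᵀ * (Λ₁f v) * Q₁₁ (hv v)) + ((Q₁₀ᵀ * (Λ₁f v) * Q₁₀) * (-((((Lc : ℝ) ^ (3 + 1) * stepScale 3 Lc 0)⁻¹) • Matrix.diagonal (fun b : ↥(pbox (fine Lc M')) × Fin (3 + 1) => (lv v) b.1))) + -((-((((Lc : ℝ) ^ (3 + 1) * stepScale 3 Lc 0)⁻¹)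 • Matrix.diagonal (fun b : ↥(pbox (fine Lc M')) × Fin (3 + 1) => (lv v) b.1)))ᵀ * (Q₁₀ᵀ * (Λ₁f v) * Q₁₀))) + ((Q₁₀ᵀ * (Λ₁f v) * Q₁₀) * (-((((Lc : ℝ) ^ (3 + 1) * stepScale 3 Lc 0)⁻¹) • Matrix.diagonal (fun b : ↥(pbox (fine Lc M')) × Fin (3 + 1) => (lv v) b.1))) + -((-((((Lc : ℝ) ^ (3 + 1) * stepScale 3 Lc 0)⁻¹) • Matrix.diagonal (fun b : ↥(pbox (fine Lc M')) × Fin (3 + 1) => (lv v) b.1)))ᵀ * (Q₁₀ᵀ * (Λ₁f v) * Q₁₀))))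
          = H'₂f v v + N₂cf v v + (e.1 + Q₁₀ᵀ * e.2 * Q₁₀) := by
        rw [hN₂cd]; abel
      rw [eN] at h
      simpa only [add_zero] using h)
    d (fun k l => (EF k l, EC k l)) (fun k l => Prod.ext (hEFs k l) (hECs k l))
    (fun r => ⟨by
        simp only [Prod.fst_sum, Prod.smul_fst]
        exact Summit.QuantumFields.BalabanUV.Beta.FP.DirectionalDoorKernelLaw.transpose_sum_sum_smul_of_swap r EF hEFt, by
        simp only [Prod.snd_sum, Prod.smul_snd]
        exact Summit.QuantumFields.BalabanUV.Beta.FP.DirectionalDoorKernelLaw.transpose_sum_sum_smul_of_swap r EC hECt⟩) k l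

end Summit.QuantumFields.BalabanUV.Beta.FP.LevelZeroDoorSocketCompanion

end
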